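import Summits.QuantumFields.QCD.Theorems.QuarksAsStableActionSmallHoppingDiamagnetismPaths

/-!
# Small-hopping diamagnetism (stmt-QuantumFields-9738): the algebraic lattice Stokes bound

Group-theoretic core of the locality estimate of the hopping expansion.  For a gauge field `V` on
the four-torus with values in any group `G` and a *length function* `δ : G → ℝ` which is
subadditive (`δ (g h) ≤ δ g + δ h`), conjugation invariant, inversion invariant and vanishes at `1`
(for unitary `ρ` one takes `δ g = ‖1 - ρ g‖_F = √(2 (N - Re tr ρ g))`, see the sibling `…Deficit`
file):

* `hol_swap` : exchanging two consecutive letters of a word multiplies its holonomy on the left by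
  a (generalised) plaquette `hol V x [a, b, a⁻¹, b⁻¹]`;
* `delta_genPlaquette` : the length of a generalised plaquette is the length of an honest
  plaquette holonomy `plaquetteHolonomy V (x + o) μ ν` at an offset `o` depending only on the two
  letters;
* `exists_bubble` : moving a letter to the front of a word costs one plaquette per letter jumped;
* `exists_stokes` (**algebraic Stokes theorem**) : for a balanced word `w` there is a list `P` of
  at most `|w|²` (offset, plane) data, depending only on `w`, such that for every `V` and `x`,
  `δ (hol V x w) ≤ Σ_{(o,μ,ν) ∈ P} δ (plaquetteHolonomy V (x + o) μ ν)`.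
-/

noncomputable section

namespace Summit.QuantumFields.QCD.Theorems.SmallHopping

open Literature.Probability.LatticeModels Literature.MathematicalPhysics.QuantumLattice
  Literature.MathematicalPhysics.QuantumFieldTheory

variable {L : ℕ} {G : Type*} [Group G]

/-! ## Balanced words -/

/-- Unfolding of `balanced`. -/
theorem balanced_iff (w : List Letter) :
    balanced w = true ↔ ∀ l : Letter, w.count l = w.count l.inv := by
  simp [balanced]

/-- A letter differs from its inverse. -/
theorem Letter.inv_ne (l : Letter) : l.inv ≠ l := by
  obtain ⟨μ, b⟩ := l
  cases b <;> simp [Letter.inv]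

/-- In a balanced word with first letter `l`, the inverse letter `l⁻¹` occurs later on. -/
theorem inv_mem_of_balanced_cons {l : Letter} {u : List Letter} (h : balanced (l :: u) = true) :
    l.inv ∈ u := by
  rw [balanced_iff] at h
  have h1 := h l
  rw [List.count_cons_self, List.count_cons] at h1
  have h2 : (l == l.inv) = false := by simpa using (Letter.inv_ne l).symm
  rw [h2] at h1
  exact List.count_pos_iff.mp (by simp at h1; omega)

/-- Removing a letter together with one occurrence of its inverse keeps a word balanced. -/
theorem balanced_remove {l : Letter} {u₁ u₂ : List Letter}
    (h : balanced (l :: (u₁ ++ l.inv :: u₂)) = true) : balanced (u₁ ++ u₂) = true := by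
  rw [balanced_iff] at h ⊢
  intro a
  have h1 := h a
  simp only [List.count_cons, List.count_append] at h1 ⊢
  have e1 : (l.inv == a.inv) = (l == a) := by
    obtain ⟨μ, b⟩ := l; obtain ⟨ν, c⟩ := a
    cases b <;> cases c <;> simp [Letter.inv]
  have e2 : (l == a.inv) = (l.inv == a) := by
    obtain ⟨μ, b⟩ := l; obtain ⟨ν, c⟩ := a
    cases b <;> cases c <;> simp [Letter.inv]
  rw [e1, e2] at h1
  omega

/-! ## Swapping letters: generalised plaquettes -/

/-- **Swap identity**: exchanging the first two letters of a word multiplies the holonomy on the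
left by the generalised plaquette `hol V x [a, b, a⁻¹, b⁻¹]` (valid for all letters `a`, `b`). -/
theorem hol_swap (V : GaugeConfig 4 L G) (x : TorusSite 4 L) (a b : Letter) (w : List Letter) :
    hol V x (a :: b :: w) = hol V x [a, b, a.inv, b.inv] * hol V x (b :: a :: w) := by
  have h1 : link V (x + stepVec a + stepVec b) a.inv = (link V (x + stepVec b) a)⁻¹ := by
    rw [show x + stepVec a + stepVec b = x + stepVec b + stepVec a by abel, link_inv]
  have h2 : link V (x + stepVec a + stepVec b + stepVec a.inv) b.inv = (link V x b)⁻¹ := by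
    rw [show x + stepVec a + stepVec b + stepVec a.inv = x + stepVec b by simp; abel, link_inv]
  simp only [hol_cons, hol_nil, mul_one, h1, h2, show x + stepVec b + stepVec a = x + stepVec a + stepVec b by abel]
  group

/-- **Generalised versus honest plaquettes.**  For letters in different directions, the generalised
plaquette `hol V x [a, b, a⁻¹, b⁻¹]` is a conjugate of the plaquette holonomy
`plaquetteHolonomy V (x + gpOffset a b) a.1 b.1` or of its inverse. -/
theorem genPlaquette_conj (V : GaugeConfig 4 L G) (x : TorusSite 4 L) (a b : Letter) :
    ∃ c : G, hol V x [a, b, a.inv, b.inv] =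
        c * plaquetteHolonomy V (x + gpOffset a b) a.1 b.1 * c⁻¹ ∨
      hol V x [a, b, a.inv, b.inv] =
        c * (plaquetteHolonomy V (x + gpOffset a b) a.1 b.1)⁻¹ * c⁻¹ := by
  obtain ⟨μ, sa⟩ := a
  obtain ⟨ν, sb⟩ := b
  cases sa <;> cases sb <;>
    simp only [hol_cons, hol_nil, mul_one, link, stepVec, Letter.inv, gpOffset, plaquetteHolonomy,
      Literature.MathematicalPhysics.QuantumFieldTheory.Site.shift, Bool.not_false, Bool.not_true,
      Bool.false_eq_true, ↓reduceIte, add_zero, zero_add]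
  · -- `a` backward, `b` backward: a conjugate of the plaquette at `x - e_μ - e_ν`
    refine ⟨(V (x + -Pi.single μ 1, μ))⁻¹ * (V (x + -Pi.single μ 1 + -Pi.single ν 1, ν))⁻¹,
      Or.inl ?_⟩
    abel_nf
    group
  · -- `a` backward, `b` forward: a conjugate of the inverse plaquette at `x - e_μ`
    refine ⟨(V (x + -Pi.single μ 1, μ))⁻¹, Or.inr ?_⟩
    abel_nf
    group
  · -- `a` forward, `b` backward: a conjugate of the inverse plaquette at `x - e_ν`
    refine ⟨(V (x + -Pi.single ν 1, ν))⁻¹, Or.inr ?_⟩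
    abel_nf
    group
  · -- both forward: the plaquette at `x` itself
    refine ⟨1, Or.inl ?_⟩
    abel_nf
    group

/-! ## Length functions and the bubble / Stokes lemmas -/

section Length

variable (δ : G → ℝ) (hmul : ∀ g h : G, δ (g * h) ≤ δ g + δ h)
  (hconj : ∀ c g : G, δ (c * g * c⁻¹) = δ g) (hinv : ∀ g : G, δ g⁻¹ = δ g) (hone : δ 1 = 0)

include hconj hinv in
/-- The length of a generalised plaquette is the length of the honest plaquette at the offset
`gpOffset a b` (for parallel letters both sides vanish). -/
theorem delta_genPlaquette (V : GaugeConfig 4 L G) (x : TorusSite 4 L) (a b : Letter) :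
    δ (hol V x [a, b, a.inv, b.inv]) = δ (plaquetteHolonomy V (x + gpOffset a b) a.1 b.1) := by
  obtain ⟨c, h | h⟩ := genPlaquette_conj V x a b
  · rw [h, hconj]
  · rw [h, hconj, hinv]

/-- The plaquette lengths listed in a shifted copy of `P`, read at the base point `x`, are those of
`P` read at the shifted base point. -/
theorem sum_map_shift (V : GaugeConfig 4 L G) (P : List (TorusSite 4 L × Fin 4 × Fin 4))
    (s x : TorusSite 4 L) :
    ((P.map fun t => (s + t.1, t.2)).map fun t => δ (plaquetteHolonomy V (x + t.1) t.2.1 t.2.2)).sum =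
      (P.map fun t => δ (plaquetteHolonomy V (x + s + t.1) t.2.1 t.2.2)).sum := by
  simp [List.map_map, Function.comp_def, add_assoc]

include hmul hconj hinv hone in
/-- **Bubble lemma.**  Moving the letter `l` from behind the block `u₁` to the front of the word
multiplies the holonomy by a group element of length at most one plaquette length per letter of
`u₁`, the plaquettes sitting at offsets depending only on the word. -/
theorem exists_bubble (u₁ : List Letter) (l : Letter) (u₂ : List Letter) :
    ∃ P : List (TorusSite 4 L × Fin 4 × Fin 4), P.length = u₁.length ∧
      ∀ (V : GaugeConfig 4 L G) (x : TorusSite 4 L), ∃ Q : G,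
        hol V x (u₁ ++ l :: u₂) = Q * hol V x (l :: (u₁ ++ u₂)) ∧
        δ Q ≤ (P.map fun t => δ (plaquetteHolonomy V (x + t.1) t.2.1 t.2.2)).sum := by
  induction u₁ with
  | nil =>
    refine ⟨[], rfl, fun V x => ⟨1, by simp, ?_⟩⟩
    simp [hone]
  | cons a u₁ ih =>
    obtain ⟨P', hP'len, hP'⟩ := ih
    refine ⟨((gpOffset a l : TorusSite 4 L), a.1, l.1) :: P'.map (fun t => (stepVec a + t.1, t.2)),
      by simp [hP'len], fun V x => ?_⟩
    obtain ⟨Q', hQ'eq, hQ'le⟩ := hP' V (x + stepVec a)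
    refine ⟨link V x a * Q' * (link V x a)⁻¹ * hol V x [a, l, a.inv, l.inv], ?_, ?_⟩
    · have hs' : hol V x (l :: a :: (u₁ ++ u₂)) =
          (hol V x [a, l, a.inv, l.inv])⁻¹ * (link V x a * hol V (x + stepVec a) (l :: (u₁ ++ u₂))) := by
        rw [eq_inv_mul_iff_mul_eq, ← hol_cons]
        exact (hol_swap V x a l _).symm
      rw [List.cons_append, hol_cons, hQ'eq, List.cons_append, hs']
      group
    · calc δ (link V x a * Q' * (link V x a)⁻¹ * hol V x [a, l, a.inv, l.inv])
          ≤ δ (link V x a * Q' * (link V x a)⁻¹) + δ (hol V x [a, l, a.inv, l.inv]) := hmul _ _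
        _ = δ Q' + δ (plaquetteHolonomy V (x + gpOffset a l) a.1 l.1) := by
            rw [hconj, delta_genPlaquette δ hconj hinv]
        _ ≤ _ := by
            rw [List.map_cons, List.sum_cons, sum_map_shift]
            dsimp only
            linarith

include hmul hconj hinv hone in
/-- **Algebraic lattice Stokes theorem.**  For a balanced word `w` there is a list `P` of at most
`|w|²` (offset, plane) data, depending only on `w`, such that for every gauge field `V` and every
base point `x` the length of the holonomy of `w` is at most the total length of the listed
plaquette holonomies `plaquetteHolonomy V (x + o) μ ν`, `(o, μ, ν) ∈ P`.  (Induction: pair the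
first letter with an occurrence of its inverse, bubble the inverse to the front at the cost of one
plaquette per letter jumped, cancel the backtrack, and recurse on the shorter balanced word.) -/
theorem exists_stokes (n : ℕ) :
    ∀ w : List Letter, w.length ≤ n → balanced w = true →
      ∃ P : List (TorusSite 4 L × Fin 4 × Fin 4), P.length ≤ w.length ^ 2 ∧
        ∀ (V : GaugeConfig 4 L G) (x : TorusSite 4 L),
          δ (hol V x w) ≤ (P.map fun t => δ (plaquetteHolonomy V (x + t.1) t.2.1 t.2.2)).sum := by
  induction n with
  | zero =>
    intro w hw _
    rw [Nat.le_zero, List.length_eq_zero_iff] at hw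
    subst hw
    exact ⟨[], by simp, fun V x => by simp [hone]⟩
  | succ n ih =>
    intro w hw hbal
    cases w with
    | nil => exact ⟨[], by simp, fun V x => by simp [hone]⟩
    | cons l u =>
      obtain ⟨u₁, u₂, rfl⟩ := List.append_of_mem (inv_mem_of_balanced_cons hbal)
      obtain ⟨P₁, hP₁len, hP₁⟩ := exists_bubble δ hmul hconj hinv hone u₁ l.inv u₂
      have hlen : (u₁ ++ u₂).length ≤ n := by
        simp only [List.length_cons, List.length_append] at hw ⊢
        omega
      obtain ⟨P₂, hP₂len, hP₂⟩ := ih (u₁ ++ u₂) hlen (balanced_remove hbal)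
      refine ⟨P₁.map (fun t => (stepVec l + t.1, t.2)) ++ P₂, ?_, fun V x => ?_⟩
      · simp only [List.length_append, List.length_map, hP₁len, List.length_cons] at hP₂len ⊢
        nlinarith [Nat.zero_le u₁.length, Nat.zero_le u₂.length]
      · obtain ⟨Q, hQeq, hQle⟩ := hP₁ V (x + stepVec l)
        have key : hol V x (l :: (u₁ ++ l.inv :: u₂)) =
            link V x l * Q * (link V x l)⁻¹ * hol V x (u₁ ++ u₂) := by
          rw [hol_cons, hQeq, ← hol_cons_inv_cons V x l (u₁ ++ u₂), hol_cons V x l]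
          group
        rw [key, List.map_append, List.sum_append, sum_map_shift δ V]
        calc δ (link V x l * Q * (link V x l)⁻¹ * hol V x (u₁ ++ u₂))
            ≤ δ (link V x l * Q * (link V x l)⁻¹) + δ (hol V x (u₁ ++ u₂)) := hmul _ _
          _ ≤ _ := by
              rw [hconj]
              exact add_le_add hQle (hP₂ V x)

end Length

end Summit.QuantumFields.QCD.Theorems.SmallHopping
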